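import Literature.NumberTheory.Sieve.PolymathLcmSumsFourier
import HarnessLib

/-!
# The Fourier majorant for `λ_F(n)²` (proof of Prop. 4.2, pp. 14–15)

Trunk AntSieve, tooling toward the named fact `Literature.NumberTheory.Sieve.weakDHL_three_two_of_GEH`
(D. H. J. Polymath, Res. Math. Sci. 1:12 (2014) = arXiv:1407.4897, Theorem 3.2(xii)), here the
first step of the proof of Proposition 4.2 (almost primality), pp. 14–15: "we can use Fourier
expansion to write `F_j(log_x d) = ∫ f_j(ξ) d^{-(1+iξ)/log x} dξ` … which factorizes using Euler
products as `λ_{F_j}(n) = ∫ ∏_{p∣n} (1 - p^{-(1+iξ)/log x}) f_j(ξ) dξ`. The function has …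
`1 - p^{-(1+iξ)/log x} = O(min((1+|ξ|) log_x p, 1))` … `|λ_{F_j}(n)|^{a_j} ≪ τ(n)^{O(1)} ∫ … ∏_{p∣n} min(σ log_x p, 1) …`."

For `a_j = 2` we avoid squaring the integral: `λ_F(n)² = |λ_F(n)| · |λ_F(n)| ≤ (2^{ω(n)} ‖f‖₁) ·
(2^{ω(n)} ∫ |f(ξ)| ∏_{p∣n} min((1+2π|ξ|) log_x p, 1) dξ)`.

* `eulerMajor σ x n = ∏_{p ∣ n} min(σ log p/log x, 1)`;
* `divisorSumWeight_eq_integral_euler` — `λ_F(n) = ∫ f(ξ) ∏_{p∣n} (1 - p^{-(1-2πiξ)/log x}) dξ`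
  (Mathlib's normalisation of the Fourier transform);
* `norm_one_sub_kernel_le` — `|1 - p^{-(1-2πiξ)/log x}| ≤ min((1+2π|ξ|) log_x p, 2)`;
* `sq_divisorSumWeight_le` — **`λ_F(n)² ≤ 4^{ω(n)} ‖f‖₁ ∫ |f(ξ)| ∏_{p∣n} min((1+2π|ξ|) log_x p, 1) dξ`**.

## References

* [Polymath8b2014] D. H. J. Polymath, Res. Math. Sci. 1 (2014), Art. 12 = arXiv:1407.4897,
  proof of Proposition 4.2, pp. 14–15.
-/

noncomputable section

open MeasureTheory Finset Real Filter
open scoped ArithmeticFunction.Moebius ArithmeticFunction.omega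

namespace Literature.NumberTheory.Sieve

open scoped Classical

namespace FourierMajorant

/-! ### The Euler-product majorant -/

/-- `∏_{p ∣ n} min(σ log p / log x, 1)`. [cite: Polymath8b2014, proof of Prop. 4.2, p. 15] -/
def eulerMajor (σ x : ℝ) (n : ℕ) : ℝ := ∏ p ∈ n.primeFactors, min (σ * (Real.log p / Real.log x)) 1

/-- `0 ≤ eulerMajor ≤ 1` for `σ ≥ 0`, `x ≥ 1`. [folklore] -/
theorem eulerMajor_nonneg {σ x : ℝ} (hσ : 0 ≤ σ) (hx : 1 ≤ x) (n : ℕ) : 0 ≤ eulerMajor σ x n :=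
  Finset.prod_nonneg fun p hp => le_min (mul_nonneg hσ (div_nonneg
    (Real.log_nonneg (by exact_mod_cast (Nat.prime_of_mem_primeFactors hp).one_le)) (Real.log_nonneg hx))) zero_le_one

/-- `eulerMajor ≤ 1`. [folklore] -/
theorem eulerMajor_le_one {σ x : ℝ} (hσ : 0 ≤ σ) (hx : 1 ≤ x) (n : ℕ) : eulerMajor σ x n ≤ 1 :=
  Finset.prod_le_one (fun p hp => le_min (mul_nonneg hσ (div_nonneg
    (Real.log_nonneg (by exact_mod_cast (Nat.prime_of_mem_primeFactors hp).one_le)) (Real.log_nonneg hx))) zero_le_one)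
    fun p _ => min_le_right _ _

/-- Monotonicity in `σ`. [folklore] -/
theorem eulerMajor_mono {σ σ' x : ℝ} (hσ : 0 ≤ σ) (hσσ' : σ ≤ σ') (hx : 1 ≤ x) (n : ℕ) : eulerMajor σ x n ≤ eulerMajor σ' x n := by
  refine Finset.prod_le_prod (fun p hp => le_min (mul_nonneg hσ (div_nonneg
    (Real.log_nonneg (by exact_mod_cast (Nat.prime_of_mem_primeFactors hp).one_le)) (Real.log_nonneg hx))) zero_le_one) fun p hp => ?_
  exact min_le_min_right _ (mul_le_mul_of_nonneg_right hσσ' (div_nonneg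
    (Real.log_nonneg (by exact_mod_cast (Nat.prime_of_mem_primeFactors hp).one_le)) (Real.log_nonneg hx)))

/-- Continuity in `σ`. [folklore] -/
theorem continuous_eulerMajor (x : ℝ) (n : ℕ) : Continuous fun σ => eulerMajor σ x n :=
  continuous_finsetProd _ fun _ _ => (continuous_id.mul continuous_const).min continuous_const

/-! ### The kernel `p^{-(1-2πiξ)/log x}` and its distance to `1` -/

/-- `|1 - e^{-t(1-2πiξ)}| ≤ t (1 + 2π|ξ|)` for `t ≥ 0`. [cite: Polymath8b2014, proof of Prop. 4.2, p. 15] -/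
theorem norm_one_sub_lcmFourierKernel_le {t : ℝ} (ht : 0 ≤ t) (ξ : ℝ) :
    ‖1 - lcmFourierKernel t ξ‖ ≤ t * (1 + 2 * π * |ξ|) := by
  set θ := 2 * π * ξ * t with hθ
  have hz : (-(t : ℂ) * (1 - 2 * π * Complex.I * ξ)) = ⟨-t, θ⟩ := by
    apply Complex.ext
    · simp
    · simp [hθ]; ring
  have hre : (1 - lcmFourierKernel t ξ).re = 1 - Real.exp (-t) * Real.cos θ := by
    rw [lcmFourierKernel, hz, Complex.sub_re, Complex.one_re, Complex.exp_re]
  have him : (1 - lcmFourierKernel t ξ).im = -(Real.exp (-t) * Real.sin θ) := by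
    rw [lcmFourierKernel, hz, Complex.sub_im, Complex.one_im, Complex.exp_im]; ring
  have hsq : ‖1 - lcmFourierKernel t ξ‖ ^ 2 ≤ (t * (1 + 2 * π * |ξ|)) ^ 2 := by
    rw [Complex.sq_norm, Complex.normSq_apply, hre, him]
    have he : Real.exp (-t) ≤ 1 := by rw [Real.exp_le_one_iff]; linarith
    have he0 : 0 < Real.exp (-t) := Real.exp_pos _
    have h1 : 1 - Real.exp (-t) ≤ t := by have := Real.add_one_le_exp (-t); linarith
    have h1' : 0 ≤ 1 - Real.exp (-t) := by linarith
    have hcos : 1 - Real.cos θ ≤ θ ^ 2 / 2 := by have := Real.one_sub_sq_div_two_le_cos (x := θ); linarith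
    have hcs : Real.cos θ ^ 2 + Real.sin θ ^ 2 = 1 := Real.cos_sq_add_sin_sq θ
    -- `(1 - e cos)² + (e sin)² = (1 - e)² + 2 e (1 - cos)`
    have hid : (1 - Real.exp (-t) * Real.cos θ) * (1 - Real.exp (-t) * Real.cos θ) +
        -(Real.exp (-t) * Real.sin θ) * -(Real.exp (-t) * Real.sin θ) =
        (1 - Real.exp (-t)) ^ 2 + 2 * Real.exp (-t) * (1 - Real.cos θ) := by nlinarith [hcs]
    rw [hid]
    have hθ2 : θ ^ 2 = t ^ 2 * (2 * π * |ξ|) ^ 2 := by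
      rw [hθ, mul_pow, mul_pow, mul_pow, mul_pow, sq_abs]; ring
    calc (1 - Real.exp (-t)) ^ 2 + 2 * Real.exp (-t) * (1 - Real.cos θ) ≤ t ^ 2 + 2 * 1 * (θ ^ 2 / 2) := by
          refine add_le_add (pow_le_pow_left₀ h1' h1 2) ?_
          exact mul_le_mul (mul_le_mul_of_nonneg_left he (by norm_num)) hcos (by linarith [Real.cos_le_one θ]) (by norm_num)
      _ = t ^ 2 * (1 + (2 * π * |ξ|) ^ 2) := by rw [hθ2]; ring
      _ ≤ (t * (1 + 2 * π * |ξ|)) ^ 2 := by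
          have h0 : 0 ≤ 2 * π * |ξ| := by positivity
          nlinarith [mul_nonneg (sq_nonneg t) h0]
  have hB : 0 ≤ t * (1 + 2 * π * |ξ|) := by positivity
  exact (pow_le_pow_iff_left₀ (norm_nonneg _) hB two_ne_zero).1 hsq

/-- `|1 - e^{-t(1-2πiξ)}| ≤ 2` for `t ≥ 0`. [folklore] -/
theorem norm_one_sub_lcmFourierKernel_le_two {t : ℝ} (ht : 0 ≤ t) (ξ : ℝ) : ‖1 - lcmFourierKernel t ξ‖ ≤ 2 := by
  calc ‖1 - lcmFourierKernel t ξ‖ ≤ ‖(1 : ℂ)‖ + ‖lcmFourierKernel t ξ‖ := norm_sub_le _ _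
    _ = 1 + Real.exp (-t) := by rw [norm_one, norm_lcmFourierKernel]
    _ ≤ 2 := by have : Real.exp (-t) ≤ 1 := by rw [Real.exp_le_one_iff]; linarith
                linarith

/-- **`|1 - p^{-(1-2πiξ)/log x}| ≤ 2 min((1 + 2π|ξ|) log p/log x, 1)`** for `p ≥ 1`, `x > 1`.
[cite: Polymath8b2014, proof of Prop. 4.2, p. 15] -/
theorem norm_one_sub_kernel_le {x : ℝ} (hx : 1 < x) {p : ℕ} (hp : 1 ≤ p) (ξ : ℝ) :
    ‖1 - lcmFourierKernel (Real.log p / Real.log x) ξ‖ ≤ 2 * min ((1 + 2 * π * |ξ|) * (Real.log p / Real.log x)) 1 := by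
  have ht : 0 ≤ Real.log p / Real.log x := div_nonneg (Real.log_nonneg (by exact_mod_cast hp)) (Real.log_nonneg hx.le)
  rcases le_or_gt ((1 + 2 * π * |ξ|) * (Real.log p / Real.log x)) 1 with h | h
  · rw [min_eq_left h]
    have := norm_one_sub_lcmFourierKernel_le ht ξ
    nlinarith [norm_nonneg (1 - lcmFourierKernel (Real.log p / Real.log x) ξ)]
  · rw [min_eq_right h.le, mul_one]; exact norm_one_sub_lcmFourierKernel_le_two ht ξ

/-! ### `λ_F(n)` as an integral of Euler products -/

/-- The completely multiplicative function `d ↦ d^{-(1-2πiξ)/log x}` (zero at `0`). [folklore] -/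
def kerFun (x ξ : ℝ) : ArithmeticFunction ℂ :=
  ⟨fun d => if d = 0 then 0 else lcmFourierKernel (Real.log d / Real.log x) ξ, if_pos rfl⟩

/-- Unfolding `kerFun` at `d ≠ 0`. [folklore] -/
theorem kerFun_apply {x ξ : ℝ} {d : ℕ} (hd : d ≠ 0) : kerFun x ξ d = lcmFourierKernel (Real.log d / Real.log x) ξ := by
  rw [kerFun, ArithmeticFunction.coe_mk, if_neg hd]

/-- `kerFun` is multiplicative (indeed completely multiplicative). [folklore] -/
theorem isMultiplicative_kerFun (x ξ : ℝ) : (kerFun x ξ).IsMultiplicative := by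
  refine ⟨by rw [kerFun_apply one_ne_zero]; simp [lcmFourierKernel], fun {m n} _ => ?_⟩
  rcases eq_or_ne m 0 with rfl | hm
  · simp [kerFun]
  rcases eq_or_ne n 0 with rfl | hn
  · simp [kerFun]
  rw [kerFun_apply (mul_ne_zero hm hn), kerFun_apply hm, kerFun_apply hn, lcmFourierKernel, lcmFourierKernel, lcmFourierKernel,
    ← Complex.exp_add, Nat.cast_mul, Real.log_mul (by exact_mod_cast hm) (by exact_mod_cast hn)]
  congr 1
  push_cast
  ring

/-- **Möbius sums over all divisors reduce to the radical**: for multiplicative `g`,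
`Σ_{d ∣ n} μ(d) g(d) = ∏_{p ∣ n} (1 - g(p))` (`n ≥ 1`). [folklore] -/
theorem sum_divisors_moebius_mul_eq_prod {R : Type*} [CommRing R] {g : ArithmeticFunction R} (hg : g.IsMultiplicative)
    {n : ℕ} (hn : n ≠ 0) : ∑ d ∈ n.divisors, (μ d : R) * g d = ∏ p ∈ n.primeFactors, (1 - g p) := by
  set m := ∏ p ∈ n.primeFactors, p with hm
  have hmsq : Squarefree m := by
    rw [hm]
    refine Finset.squarefree_prod_of_pairwise_isCoprime (fun p hp q hq hpq => ?_)
      fun p hp => (Nat.prime_of_mem_primeFactors hp).squarefree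
    simp only [← Nat.coprime_iff_isRelPrime]
    exact (Nat.coprime_primes (Nat.prime_of_mem_primeFactors hp) (Nat.prime_of_mem_primeFactors hq)).mpr hpq
  have hmfac : m.primeFactors = n.primeFactors := Nat.primeFactors_prod_primeFactors n
  have hmn : m ∣ n := Nat.prod_primeFactors_dvd n
  -- the Möbius sum over the divisors of `n` equals that over the divisors of `m`
  have hsum : ∑ d ∈ n.divisors, (μ d : R) * g d = ∑ d ∈ m.divisors, (μ d : R) * g d := by
    refine (Finset.sum_subset (Nat.divisors_subset_of_dvd hn hmn) fun d hdn hdm => ?_).symm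
    -- `d ∣ n`, `d ∤ m`: `d` is not squarefree
    have hd : ¬ Squarefree d := by
      intro hsq
      apply hdm
      rw [Nat.mem_divisors]
      refine ⟨?_, hmsq.ne_zero⟩
      rw [← Nat.prod_primeFactors_of_squarefree hsq, hm]
      exact Finset.prod_dvd_prod_of_subset _ _ _ (Nat.primeFactors_mono (Nat.dvd_of_mem_divisors hdn) hn)
    rw [ArithmeticFunction.moebius_eq_zero_of_not_squarefree hd]; simp
  rw [hsum, ← hmfac, ← ArithmeticFunction.IsMultiplicative.prodPrimeFactors_one_sub_of_squarefree g hg hmsq]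

/-- The Möbius sum of the kernel factorises: `Σ_{d ∣ n} μ(d) d^{-(1-2πiξ)/log x} = ∏_{p ∣ n} (1 - p^{-(1-2πiξ)/log x})`.
[cite: Polymath8b2014, proof of Prop. 4.2, p. 15] -/
theorem sum_divisors_moebius_kernel {x ξ : ℝ} {n : ℕ} (hn : n ≠ 0) :
    ∑ d ∈ n.divisors, (μ d : ℂ) * lcmFourierKernel (Real.log d / Real.log x) ξ =
      ∏ p ∈ n.primeFactors, (1 - lcmFourierKernel (Real.log p / Real.log x) ξ) := by
  have h := sum_divisors_moebius_mul_eq_prod (isMultiplicative_kerFun x ξ) hn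
  rw [Finset.sum_congr rfl fun d hd => by rw [kerFun_apply (Nat.pos_of_mem_divisors hd).ne']] at h
  rw [h]
  exact Finset.prod_congr rfl fun p hp => by rw [kerFun_apply (Nat.prime_of_mem_primeFactors hp).ne_zero]

/-- The Euler product at `n`, as a function of `ξ`. [cite: Polymath8b2014, proof of Prop. 4.2, p. 15] -/
def eulerKer (x : ℝ) (n : ℕ) (ξ : ℝ) : ℂ := ∏ p ∈ n.primeFactors, (1 - lcmFourierKernel (Real.log p / Real.log x) ξ)

/-- `ξ ↦ E_n(ξ)` is continuous. [folklore] -/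
theorem continuous_eulerKer (x : ℝ) (n : ℕ) : Continuous (eulerKer x n) := by
  unfold eulerKer lcmFourierKernel
  refine continuous_finsetProd _ fun p _ => continuous_const.sub (Complex.continuous_exp.comp ?_)
  fun_prop

/-- **`|E_n(ξ)| ≤ 2^{ω(n)} ∏_{p∣n} min((1+2π|ξ|) log_x p, 1)`** (`x > 1`). [cite: Polymath8b2014, proof of Prop. 4.2, p. 15] -/
theorem norm_eulerKer_le {x : ℝ} (hx : 1 < x) (n : ℕ) (ξ : ℝ) :
    ‖eulerKer x n ξ‖ ≤ 2 ^ ω n * eulerMajor (1 + 2 * π * |ξ|) x n := by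
  rw [eulerKer, eulerMajor, ArithmeticFunction.cardDistinctFactors_apply, ← List.card_toFinset, Nat.toFinset_factors,
    ← Finset.prod_const, ← Finset.prod_mul_distrib]
  refine (Finset.norm_prod_le _ _).trans (Finset.prod_le_prod (fun p _ => norm_nonneg _) fun p hp => ?_)
  exact norm_one_sub_kernel_le hx (Nat.prime_of_mem_primeFactors hp).one_le ξ

/-- `|E_n(ξ)| ≤ 2^{ω(n)}`. [folklore] -/
theorem norm_eulerKer_le_two_pow {x : ℝ} (hx : 1 < x) (n : ℕ) (ξ : ℝ) : ‖eulerKer x n ξ‖ ≤ 2 ^ ω n := by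
  refine (norm_eulerKer_le hx n ξ).trans ?_
  have := eulerMajor_le_one (σ := 1 + 2 * π * |ξ|) (by positivity) hx.le n
  have h2 : (0 : ℝ) ≤ 2 ^ ω n := by positivity
  nlinarith

/-- **`λ_F(n) = ∫ f(ξ) E_n(ξ) dξ`** for `n ≥ 1`, `x > 1`. [cite: Polymath8b2014, proof of Prop. 4.2, pp. 14–15] -/
theorem divisorSumWeight_eq_integral_euler {F : ℝ → ℝ} {s : ℝ} (hF : IsSieveCutoff F s) {x : ℝ} (hx : 1 < x) {n : ℕ} (hn : n ≠ 0) :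
    (divisorSumWeight F x n : ℂ) = ∫ ξ : ℝ, hF.fourierWeight ξ * eulerKer x n ξ := by
  have hlogx : 0 < Real.log x := Real.log_pos hx
  -- each `F(log_x d) = ∫ f K_d`
  have hF_d : ∀ d ∈ n.divisors, (F (Real.log d / Real.log x) : ℂ) = ∫ ξ : ℝ, hF.fourierWeight ξ * lcmFourierKernel (Real.log d / Real.log x) ξ :=
    fun d hd => hF.eq_integral_fourierWeight (le_trans (by norm_num) (div_nonneg
      (Real.log_nonneg (by exact_mod_cast Nat.pos_of_mem_divisors hd)) hlogx.le))
  have hint : ∀ d ∈ n.divisors, Integrable fun ξ : ℝ => hF.fourierWeight ξ * lcmFourierKernel (Real.log d / Real.log x) ξ := by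
    intro d hd
    have ht : 0 ≤ Real.log d / Real.log x := div_nonneg (Real.log_nonneg (by exact_mod_cast Nat.pos_of_mem_divisors hd)) hlogx.le
    refine (hF.integrable_fourierWeight.norm.mono' (hF.continuous_fourierWeight.mul ?_).aestronglyMeasurable
      (Eventually.of_forall fun ξ => ?_))
    · unfold lcmFourierKernel; exact Complex.continuous_exp.comp (by fun_prop)
    · rw [norm_mul, norm_lcmFourierKernel]
      have : Real.exp (-(Real.log d / Real.log x)) ≤ 1 := by rw [Real.exp_le_one_iff]; linarith
      exact le_trans (mul_le_mul_of_nonneg_left this (norm_nonneg _)) (by rw [mul_one])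
  rw [divisorSumWeight]
  push_cast
  rw [Finset.sum_congr rfl fun d hd => by rw [hF_d d hd]]
  simp_rw [← integral_const_mul]
  rw [← integral_finsetSum _ fun d hd => (hint d hd).const_mul _]
  refine integral_congr_ae (Eventually.of_forall fun ξ => ?_)
  simp only [eulerKer]
  rw [← sum_divisors_moebius_kernel hn, Finset.mul_sum]
  refine Finset.sum_congr rfl fun d _ => by ring

/-! ### The majorant for `λ_F(n)²` -/

/-- The `L¹` norm `‖f‖₁ = ∫ |f|`. [folklore] -/
def fourierL1 {F : ℝ → ℝ} {s : ℝ} (hF : IsSieveCutoff F s) : ℝ := ∫ ξ : ℝ, ‖hF.fourierWeight ξ‖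

/-- `0 ≤ ‖f‖₁`. [folklore] -/
theorem fourierL1_nonneg {F : ℝ → ℝ} {s : ℝ} (hF : IsSieveCutoff F s) : 0 ≤ fourierL1 hF :=
  integral_nonneg fun _ => norm_nonneg _

/-- `|λ_F(n)| ≤ 2^{ω(n)} ‖f‖₁`. [folklore] -/
theorem abs_divisorSumWeight_le_L1 {F : ℝ → ℝ} {s : ℝ} (hF : IsSieveCutoff F s) {x : ℝ} (hx : 1 < x) {n : ℕ} (hn : n ≠ 0) :
    |divisorSumWeight F x n| ≤ 2 ^ ω n * fourierL1 hF := by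
  have h := divisorSumWeight_eq_integral_euler hF hx hn
  have : |divisorSumWeight F x n| = ‖(divisorSumWeight F x n : ℂ)‖ := by rw [Complex.norm_real, Real.norm_eq_abs]
  rw [this, h, fourierL1, ← integral_const_mul]
  refine (norm_integral_le_integral_norm _).trans (integral_mono_of_nonneg (Eventually.of_forall fun _ => norm_nonneg _)
    (hF.integrable_fourierWeight.norm.const_mul _) (Eventually.of_forall fun ξ => ?_))
  simp only
  rw [norm_mul, mul_comm (2 ^ ω n : ℝ)]
  exact mul_le_mul_of_nonneg_left (norm_eulerKer_le_two_pow hx n ξ) (norm_nonneg _)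

/-- The majorant integrand `|f(ξ)| ∏_{p∣n} min((1+2π|ξ|) log_x p, 1)` is integrable. [folklore] -/
theorem integrable_majorant {F : ℝ → ℝ} {s : ℝ} (hF : IsSieveCutoff F s) {x : ℝ} (hx : 1 ≤ x) (n : ℕ) :
    Integrable fun ξ : ℝ => ‖hF.fourierWeight ξ‖ * eulerMajor (1 + 2 * π * |ξ|) x n := by
  refine hF.integrable_fourierWeight.norm.mono' ?_ (Eventually.of_forall fun ξ => ?_)
  · exact (hF.continuous_fourierWeight.norm.mul ((continuous_eulerMajor x n).comp (by fun_prop))).aestronglyMeasurable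
  · rw [Real.norm_of_nonneg (mul_nonneg (norm_nonneg _) (eulerMajor_nonneg (by positivity) hx n))]
    exact le_trans (mul_le_mul_of_nonneg_left (eulerMajor_le_one (by positivity) hx n) (norm_nonneg _)) (by rw [mul_one])

/-- `|λ_F(n)| ≤ 2^{ω(n)} ∫ |f(ξ)| ∏_{p∣n} min((1+2π|ξ|) log_x p, 1) dξ`. [cite: Polymath8b2014, proof of Prop. 4.2, p. 15] -/
theorem abs_divisorSumWeight_le_majorant {F : ℝ → ℝ} {s : ℝ} (hF : IsSieveCutoff F s) {x : ℝ} (hx : 1 < x) {n : ℕ} (hn : n ≠ 0) :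
    |divisorSumWeight F x n| ≤ 2 ^ ω n * ∫ ξ : ℝ, ‖hF.fourierWeight ξ‖ * eulerMajor (1 + 2 * π * |ξ|) x n := by
  have h := divisorSumWeight_eq_integral_euler hF hx hn
  have : |divisorSumWeight F x n| = ‖(divisorSumWeight F x n : ℂ)‖ := by rw [Complex.norm_real, Real.norm_eq_abs]
  rw [this, h, ← integral_const_mul]
  refine (norm_integral_le_integral_norm _).trans (integral_mono_of_nonneg (Eventually.of_forall fun _ => norm_nonneg _)
    ((integrable_majorant hF hx.le n).const_mul _) (Eventually.of_forall fun ξ => ?_))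
  simp only
  rw [norm_mul]
  calc ‖hF.fourierWeight ξ‖ * ‖eulerKer x n ξ‖ ≤ ‖hF.fourierWeight ξ‖ * (2 ^ ω n * eulerMajor (1 + 2 * π * |ξ|) x n) :=
        mul_le_mul_of_nonneg_left (norm_eulerKer_le hx n ξ) (norm_nonneg _)
    _ = 2 ^ ω n * (‖hF.fourierWeight ξ‖ * eulerMajor (1 + 2 * π * |ξ|) x n) := by ring

/-- **The Fourier majorant for the square**:
`λ_F(n)² ≤ 4^{ω(n)} ‖f‖₁ ∫ |f(ξ)| ∏_{p∣n} min((1+2π|ξ|) log_x p, 1) dξ` (`n ≥ 1`, `x > 1`).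
[cite: Polymath8b2014, proof of Prop. 4.2, p. 15] -/
theorem sq_divisorSumWeight_le {F : ℝ → ℝ} {s : ℝ} (hF : IsSieveCutoff F s) {x : ℝ} (hx : 1 < x) {n : ℕ} (hn : n ≠ 0) :
    divisorSumWeight F x n ^ 2 ≤ 4 ^ ω n * fourierL1 hF * ∫ ξ : ℝ, ‖hF.fourierWeight ξ‖ * eulerMajor (1 + 2 * π * |ξ|) x n := by
  have h1 := abs_divisorSumWeight_le_L1 hF hx hn
  have h2 := abs_divisorSumWeight_le_majorant hF hx hn
  have hI : 0 ≤ ∫ ξ : ℝ, ‖hF.fourierWeight ξ‖ * eulerMajor (1 + 2 * π * |ξ|) x n :=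
    integral_nonneg fun ξ => mul_nonneg (norm_nonneg _) (eulerMajor_nonneg (by positivity) hx.le n)
  calc divisorSumWeight F x n ^ 2 = |divisorSumWeight F x n| * |divisorSumWeight F x n| := by rw [← sq_abs, sq]
    _ ≤ (2 ^ ω n * fourierL1 hF) * (2 ^ ω n * ∫ ξ : ℝ, ‖hF.fourierWeight ξ‖ * eulerMajor (1 + 2 * π * |ξ|) x n) :=
        mul_le_mul h1 h2 (abs_nonneg _) (mul_nonneg (by positivity) (fourierL1_nonneg hF))
    _ = 4 ^ ω n * fourierL1 hF * ∫ ξ : ℝ, ‖hF.fourierWeight ξ‖ * eulerMajor (1 + 2 * π * |ξ|) x n := by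
        rw [show (4 : ℝ) ^ ω n = 2 ^ ω n * 2 ^ ω n by rw [← mul_pow]; norm_num]; ring

end FourierMajorant

end Literature.NumberTheory.Sieve
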